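import Literature.Probability.RandomPlanarGeometry.HexSAWPolygonCellsOmegaCase1
import Literature.Probability.RandomPlanarGeometry.HexSAWPolygonCellsStickTops
import HarnessLib

/-!
# Cell calculus for honeycomb polygon surgery, XXXVIII: a ray top of OMEGA's image is a leaf

Topic `Literature/Probability/RandomPlanarGeometry` (lane «pcv-sawmu», a-p4 g22; sequel of XXXV `…OmegaErase`, XXXVI `…StickTops`, XXXVII `…OmegaCase1`).

First half of the CASE 1 / CASE 2 exclusivity of the decoder (THEOREM-OMEGA-g21 §4: «CASE 1: w is the ≺-largest ray top, a LEAF (Thm V)»): the image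
hexagon `w = LL (port c)` of a stick top `c` has exactly ONE contact in `ι S`. Proof by perimeter bookkeeping only — no adjacency case analysis:
`perim (ι S) = perim S + 2`, `perim (ι (S − c)) = perim (S − c) + 2 = perim S − 2` (XXXVI `perim_erase_stickTop`), `ι (S − c) = ι S − w` (XXXV), and the
insertion law `perim (insert w T) + 2·#contacts = perim T + 6` (part I) force `#contacts = 1`.

Sources: N. Madras, G. Slade, *The Self-Avoiding Walk* (1993), §3.2, proof of Theorem 3.2.3 [MadrasSlade1993]; I. Jensen, J. Phys.: Conf. Ser. 42 (2006) 163
[Jensen2006HoneycombPolygons].  Label (lane): LANE INFRASTRUCTURE for the lane's step-two injection; nothing new in writing.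
-/

open Finset

namespace Literature.Probability.RandomPlanarGeometry.SAW

namespace HexCell

variable {C : Finset Cell → Finset Cell} {P₀ : Finset Cell → Cell → Cell}

/-- The ray top over a stick top lies in the image. [cite: MadrasSlade1993, §3.2 (proof of Theorem 3.2.3)] -/
theorem ll_port_mem_omegaRec {S : Finset Cell} {c : Cell} (hc : c ∈ S \ peel S) :
    LL ((omegaRec C P₀ S).2 c) ∈ (omegaRec C P₀ S).1 := by
  classical
  rw [omegaRec_image_eq]
  exact mem_union_right _ (mem_image_of_mem _ hc)

/-- ★★ **A ray top is a leaf of the image**: under the hypotheses of THEOREM V's recursion (brick set, no peeled hexagon on an exceptional host, base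
ports `PortInv`, base image `+2`) and `2 ≤ #(peel S)`, for a stick top `c` the hexagon `w = LL (port c)` has exactly one contact in `(omegaRec C P₀ S).1`.
[cite: MadrasSlade1993, §3.2, Theorem 3.2.3 (3.2.3) and its proof] -/
theorem card_contacts_rayTop {X S : Finset Cell} (hS : IsBrickSet S) (h2 : 2 ≤ #(peel S))
    (hX : ∀ c ∈ S \ peel S, LL c ∉ X) (hbase : PortInv X (peel S) (C (peel S)) (P₀ (peel S)))
    (hC : perim (C (peel S)) = perim (peel S) + 2)
    {c : Cell} (hc : c ∈ S \ peel S) (hur : UR c ∉ S) :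
    #(nbrs (LL ((omegaRec C P₀ S).2 c)) ∩ (omegaRec C P₀ S).1) = 1 := by
  classical
  set W := (omegaRec C P₀ S).1 with hW
  set w := LL ((omegaRec C P₀ S).2 c) with hw
  have hwW : w ∈ W := ll_port_mem_omegaRec hc
  -- the shortened set satisfies the same hypotheses (same base)
  have hpeel := peel_erase_of_stickTop hS h2 hc hur
  have hS' : IsBrickSet (S.erase c) := fun x hx => hS x (mem_of_mem_erase hx)
  have hX' : ∀ x ∈ S.erase c \ peel (S.erase c), LL x ∉ X := by
    intro x hx
    rw [sdiff_peel_erase_of_stickTop hS h2 hc hur] at hx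
    exact hX x (mem_of_mem_erase hx)
  have hbase' : PortInv X (peel (S.erase c)) (C (peel (S.erase c))) (P₀ (peel (S.erase c))) := by rw [hpeel]; exact hbase
  have hC' : perim (C (peel (S.erase c))) = perim (peel (S.erase c)) + 2 := by rw [hpeel]; exact hC
  -- perimeters
  have h1 : perim W = perim S + 2 := perim_omegaRec_eq_add_two hS hX hbase hC
  have h2' : perim (omegaRec C P₀ (S.erase c)).1 = perim (S.erase c) + 2 := perim_omegaRec_eq_add_two hS' hX' hbase' hC'
  have h3 : perim S = perim (S.erase c) + 4 := perim_erase_stickTop hc hur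
  have h4 : (omegaRec C P₀ (S.erase c)).1 = W.erase w := omegaRec_image_erase_stickTop hS h2 hX hbase hc hur
  have h5 := perim_insert (notMem_erase w W)
  rw [insert_erase hwW] at h5
  have h6 : nbrs w ∩ W.erase w = nbrs w ∩ W := by
    ext x
    simp only [mem_inter, mem_erase]
    constructor
    · rintro ⟨hx, -, hxW⟩; exact ⟨hx, hxW⟩
    · rintro ⟨hx, hxW⟩; exact ⟨hx, fun e => self_notMem_nbrs w (e ▸ hx), hxW⟩
  rw [h6, ← h4, h2'] at h5
  omega

end HexCell

end Literature.Probability.RandomPlanarGeometry.SAW
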